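import Summits.QuantumFields.YangMills.Theses.BalabanUVNodes
import Literature.MathematicalPhysics.QuantumFieldTheory.Balaban1983to89.Node00.Record13SepCoPH
import Summits.QuantumFields.BalabanUV.Gaps.CapSignsConstRoad
import Summits.QuantumFields.BalabanUV.Gaps.D1Residue
import Summits.QuantumFields.YangMills.Theorems.BalabanUVNodesK2JsOfRecord
import Summits.QuantumFields.YangMills.Theorems.BalabanUVNodesK2Line1PrimeRemainderPrice
import Summits.QuantumFields.YangMills.Theorems.EndpointGivenBR13SepCoPH.Negative.RemNamedJets13FalseOfTwoNormalisations
import Mathlib.Analysis.SpecialFunctions.Pow.Asymptotics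
import Mathlib.Analysis.SpecialFunctions.Pow.Continuity

/-!
# Idea-2 g2 sketch — «TWO-THRESHOLD PEELING»: a MODULUS road to `EverySlope` at the FIXED record (crux K2⁷ `EndpointGivenBR13SepCoPH`,
item stmt-QuantumFields-20543)

Seat ym-nodeO-idea-2 gen 2 (IDEATOR, lens ideate-on-items).  HONEST FRAMING: nothing here proves an estimate of Bałaban's; every `def … : Prop`
keyed to the record is a HYPOTHESIS SHAPE, never a fact.  The Clay YM mass gap is NOT proved by any of this; R4 closes only the conditional
finite-𝕋⁴ rung `BalabanLadder.UV`; NODE O = [Balaban1987RG1] Thm 2 ∕ (0.31) p. 259 is UNPROVED IN PRINT.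

§1  generic real analysis: a remainder bounded by a MODULUS `ω(g_k)` of the last coupling with `ω → 0` at `0⁺` gives the every-slope currency
    `CapSignsConstRoad.EverySlope` (kernel, no sorry) — the third supplier of `EverySlope` next to `everySlope_of_epsUniform` (scheme road) and
    `everySlope_of_af1` (linear road, a = 1).
§2  the PEELING modulus `ω(g) = K·ε·g^a + V·exp(−c·ε²·(g⁻¹)^{2−2a})`, `0 < a < 1`, `0 < c` — deep small-field region at the coupling-scaled threshold
    `ε·g^a` (print's activity-LINEAR remainder chain, [Balaban1988RG2Cluster] (2.39)–(2.41) p. 21, with `ε₁ ↦ ε g^a`) + the Gaussian large-deviation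
    price of the shell `ε g^a ≤ |B′| < ε` — tends to `0` at `0⁺` (kernel, no sorry).
§3  at the record, keyed to DEF-1's NAMED numbers `θ.cβ · beta0OfJs F κ` with `κ` AFTER `θ` (the critics' sanctioned key after the two Negative lemmas of
    2026-08-28): the modulus package `ModAtN`, the stub shape 2ᴾ `PeelAtNEachJets` (and the agnostic 2ᴹᴺ `ModAtNEachJets`), and the kernel-checked, SEAM-FREE
    composition `D1AtModShadowingJets → PeelAtNEachJets → K2⁷'s TEXT` through an4's `endpointExistence_of_drift_constRemainder` BY NAME (no shift-rate, no
    anchor stub, no (190)-chain, no certified numeral); plus the generic abstract junction to LINE 2's currency (`everySlope_of_modulusBound` ⟹ `CapSignsConstRoad.EverySlope`).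
-/

noncomputable section

open Filter Topology
open scoped Matrix.Norms.L2Operator

namespace Summit.QuantumFields.YangMills.Cruxes.EndpointGivenBR13SepCoPH.Idea2g2

open Literature.MathematicalPhysics.QuantumFieldTheory.Balaban1983to89
open Literature.MathematicalPhysics.QuantumFieldTheory.Balaban1983to89.FlowStep
open Literature.MathematicalPhysics.QuantumFieldTheory.Balaban1983to89.DagBinding (EndpointExistence ForwardGenerated)
open Literature.MathematicalPhysics.QuantumFieldTheory.Balaban1983to89.T4Continuum (T4Family)
open Literature.MathematicalPhysics.QuantumFieldTheory.Balaban1983to89.Node00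
open Literature.MathematicalPhysics.QuantumFieldTheory.Balaban1983to89.Beta.RemainderChain (RemainderConst)
open Literature.MathematicalPhysics.QuantumFieldTheory.Balaban1983to89.Beta.OneStepKernelFamily (TbalOf)
open Literature.MathematicalPhysics.QuantumFieldTheory.Balaban1983to89.Beta.OneStepResolventKernel (JetData)
open Summit.QuantumFields.BalabanUV.Gaps
open Summit.QuantumFields.BalabanUV.Gaps.CapSignsConstRoad (EverySlope)

/-! ## §1 The MODULUS letter and the generic junction `ModulusBound + (ω → 0 at 0⁺) ⟹ EverySlope` -/

/-- **`ModulusBound S ω γ₁`** — the remainder of the split is bounded by a MODULUS of the LAST coupling: `|β¹_{k+1}(p)| ≤ ω(p_k)` on every history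
`p ∈ ]0,γ₁]^{k+1}`, ALL `k` (one `ω` for all scales).  With `ω g = C·g` this is (AF-1) (`CapSignsConstRoad.everySlope_of_af1`); with `ω ≡ r` it is
`RemainderConst S γ₁ r`.  A PREDICATE, never asserted. [folklore] -/
def ModulusBound {β : HBeta} (S : B12Beta.OneLoopSplit β) (ω : ℝ → ℝ) (γ₁ : ℝ) : Prop :=
  ∀ k (p : Fin (k + 1) → ℝ), p ∈ B12Beta.HistBox γ₁ k → |S.β1 k p| ≤ ω (p (Fin.last k))

/-- `ω → 0` at `0⁺` in `ε–δ` form: `∀ s > 0 ∃ δ > 0, ω ≤ s on ]0,δ]`. [folklore] -/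
def VanishesAtZero (ω : ℝ → ℝ) : Prop :=
  ∀ s : ℝ, 0 < s → ∃ δ : ℝ, 0 < δ ∧ ∀ g : ℝ, 0 < g → g ≤ δ → ω g ≤ s

/-- filter form ⟹ `ε–δ` form. [folklore] -/
theorem vanishesAtZero_of_tendsto {ω : ℝ → ℝ} (h : Tendsto ω (𝓝[>] 0) (𝓝 0)) : VanishesAtZero ω := by
  intro s hs
  have hev : ∀ᶠ g in 𝓝[>] (0 : ℝ), ω g ∈ Set.Iio s := h (isOpen_Iio.mem_nhds hs)
  obtain ⟨u, hu, hsub⟩ := mem_nhdsGT_iff_exists_Ioo_subset.mp hev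
  refine ⟨u / 2, half_pos hu, fun g hg hgle => le_of_lt ?_⟩
  have hmem : g ∈ Set.Ioo (0 : ℝ) u := ⟨hg, by linarith [Set.mem_Ioi.mp hu]⟩
  exact hsub hmem

/-- **THE GENERIC JUNCTION (kernel, no sorry): a modulus bound with `ω → 0` at `0⁺` IS the every-slope currency** — for `s > 0` take the box
`]0, min γ₁ δ(s)]`.  Third supplier of `EverySlope` (next to `everySlope_of_epsUniform`, `everySlope_of_af1`). [folklore] -/
theorem everySlope_of_modulusBound {β : HBeta} (S : B12Beta.OneLoopSplit β) {ω : ℝ → ℝ} {γ₁ : ℝ} (hγ₁ : 0 < γ₁)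
    (hω : VanishesAtZero ω) (h : ModulusBound S ω γ₁) : EverySlope S γ₁ := by
  intro s hs
  obtain ⟨δ, hδ, hδs⟩ := hω s hs
  refine ⟨min γ₁ δ, lt_min hγ₁ hδ, min_le_left _ _, fun k p hp => ?_⟩
  have hp' : p ∈ B12Beta.HistBox γ₁ k := fun i => ⟨(hp i).1, (hp i).2.trans (min_le_left _ _)⟩
  exact (h k p hp').trans (hδs _ (hp (Fin.last k)).1 ((hp (Fin.last k)).2.trans (min_le_right _ _)))

/-- the linear road is the case `ω g = C·g` (sanity: (AF-1) ⟹ `ModulusBound`). [folklore] -/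
theorem modulusBound_of_af1 {β : HBeta} (S : B12Beta.OneLoopSplit β) {C γ₀ : ℝ}
    (hAF1 : ∀ k (p : Fin (k + 1) → ℝ), p ∈ B12Beta.HistBox γ₀ k → |S.β1 k p| ≤ C * p (Fin.last k)) :
    ModulusBound S (fun g => C * g) γ₀ := hAF1

/-! ## §2 The PEELING modulus `K·ε·g^a + V·exp(−c·ε²·(g⁻¹)^{2−2a})` and its vanishing at `0⁺` -/

/-- **The two-threshold peeling modulus.**  Letters: `ε` = the record's FIXED small-field threshold (`θ.ε₂₉`), `a ∈ ]0,1[` = the peeling exponent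
(inner threshold `ε·g_k^a`), `K` = the constant of print's activity-linear remainder chain run on the DEEP region `|B′| < ε g_k^a`
([Balaban1988RG2Cluster] p. 11 «replaced by C₁ε₁», (2.39)–(2.41) p. 21: activity `O(1)C₃ε₁`, here with `ε₁ ↦ ε g^a`), `V, c` = volume∕gap constants
of the Gaussian large-deviation weight of the SHELL `ε g_k^a ≤ |B′| < ε` (fluctuation covariance `∝ g_k²` with a `k`-uniform gap:
`P(shell at a bond) ≤ exp(−c ε² g^{2a}∕g²)`).  For `g > 0`, `(g⁻¹)^{2−2a} = g^{2a−2}`. A FUNCTION, no claim. [folklore] -/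
def peelModulus (K ε a c V : ℝ) (g : ℝ) : ℝ :=
  K * ε * g ^ a + V * Real.exp (-(c * ε ^ 2 * g⁻¹ ^ (2 - 2 * a)))

/-- **the peeling modulus tends to `0` at `0⁺`** when `0 < a < 1`, `0 < c`, `ε ≠ 0` (kernel, no sorry): `g^a → 0` and `(g⁻¹)^{2−2a} → +∞`. [folklore] -/
theorem tendsto_peelModulus {K ε a c V : ℝ} (hε : ε ≠ 0) (ha0 : 0 < a) (ha1 : a < 1) (hc : 0 < c) :
    Tendsto (peelModulus K ε a c V) (𝓝[>] 0) (𝓝 0) := by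
  have h1 : Tendsto (fun g : ℝ => K * ε * g ^ a) (𝓝[>] 0) (𝓝 0) := by
    have h0 : Tendsto (fun g : ℝ => g ^ a) (𝓝[>] 0) (𝓝 0) := by
      have hca : ContinuousAt (fun g : ℝ => g ^ a) 0 := Real.continuousAt_rpow_const 0 a (Or.inr ha0.le)
      have ht := hca.tendsto
      rw [Real.zero_rpow ha0.ne'] at ht
      exact ht.mono_left nhdsWithin_le_nhds
    simpa using h0.const_mul (K * ε)
  have h2 : Tendsto (fun g : ℝ => V * Real.exp (-(c * ε ^ 2 * g⁻¹ ^ (2 - 2 * a)))) (𝓝[>] 0) (𝓝 0) := by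
    have hA : Tendsto (fun g : ℝ => g⁻¹ ^ (2 - 2 * a)) (𝓝[>] 0) atTop :=
      (tendsto_rpow_atTop (by linarith)).comp tendsto_inv_nhdsGT_zero
    have hpos : 0 < c * ε ^ 2 := mul_pos hc (by positivity)
    have hB : Tendsto (fun g : ℝ => c * ε ^ 2 * g⁻¹ ^ (2 - 2 * a)) (𝓝[>] 0) atTop := hA.const_mul_atTop hpos
    have hC : Tendsto (fun g : ℝ => Real.exp (-(c * ε ^ 2 * g⁻¹ ^ (2 - 2 * a)))) (𝓝[>] 0) (𝓝 0) :=
      Real.tendsto_exp_atBot.comp (tendsto_neg_atTop_atBot.comp hB)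
    simpa using hC.const_mul V
  show Tendsto (fun g => peelModulus K ε a c V g) _ _
  simpa [peelModulus] using h1.add h2

/-- `ε–δ` form of §2. [folklore] -/
theorem vanishesAtZero_peelModulus {K ε a c V : ℝ} (hε : ε ≠ 0) (ha0 : 0 < a) (ha1 : a < 1) (hc : 0 < c) :
    VanishesAtZero (peelModulus K ε a c V) :=
  vanishesAtZero_of_tendsto (tendsto_peelModulus hε ha0 ha1 hc)

/-- **PEELING ⟹ EVERY-SLOPE (kernel, no sorry)**: a peeling-modulus bound of the remainder on `]0,γ₁]`-histories gives `EverySlope S γ₁` —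
SEAM-FREE (no `ε₁·K_rem ≤ stepBal` constraint), DERIVATIVE-FREE (no (1.18-∂) clause, cf. cell GAPS G-pv20-3 (P1)∕(P4)), SIGN-FREE. [folklore] -/
theorem everySlope_of_peelModulusBound {β : HBeta} (S : B12Beta.OneLoopSplit β) {K ε a c V γ₁ : ℝ} (hγ₁ : 0 < γ₁)
    (hε : ε ≠ 0) (ha0 : 0 < a) (ha1 : a < 1) (hc : 0 < c) (h : ModulusBound S (peelModulus K ε a c V) γ₁) : EverySlope S γ₁ :=
  everySlope_of_modulusBound S hγ₁ (vanishesAtZero_peelModulus hε ha0 ha1 hc) h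

/-! ## §3 At the record, keyed to NAMED NUMBERS with the chart constant carried and `κ` AFTER `θ` (the critics' sanctioned key: CRIT-1 g2
`Cruxes/EndpointGivenBR13SepCoPH/CRIT-1-g2-FOLLOWTHROUGH-namedjets-normalisation.md` §2 — `∃ κ ∀ θ` and the bare slope are FALSE modulo two normalisations, tree
`Theorems/EndpointGivenBR13SepCoPH/Negative/RemNamedJets13FalseOfTwoNormalisations.lean`; CRIT-2 g2 — every shape keyed to the record's DEFINITIONAL split
`oneLoopSplit_betaOfMerged βm (beta0OfMerged βm θ.v₀) θ.γ` that forces a per-scale anchor is FALSE modulo two base histories, tree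
`…/Negative/Anchor13FalseOfTwoBaseHistories.lean`; a modulus bound forces such an anchor, so this card is NOT keyed to the definitional split) -/

section NamedNumbers

open Literature.MathematicalPhysics.QuantumFieldTheory.Balaban1983to89.Beta.Drift (OneLoopDrift)
open Summit.QuantumFields.YangMills.Theorems.BalabanUVNodesK2JsOfRecord (StepColourData beta0OfJs stepBal_L_pos)
open Summit.QuantumFields.YangMills.Theorems.BalabanUVNodesK2Line1PrimeRemainderPrice (endpointExistence_of_drift_constRemainder)
open Summit.QuantumFields.YangMills.Theorems.EndpointGivenBR13SepCoPH.Negative.RemNamedJets13FalseOfTwoNormalisations (oneLoopDrift_const_mul)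

/-- **`ModAtN F κ θ hP ω` — MODULUS PACKAGE AT THE NAMED, CHART-NORMALISED NUMBERS**: on some box `]0,γ₀] ⊆ ]0,θ.γ]` the record's β is within the modulus
`ω(g_k)` of `θ.cβ · beta0OfJs F κ k` (DEF-1 p588621's named one-loop numbers of the colour datum `κ`, scaled by the tuple's chart constant `θ.cβ` per CRIT-1 g2),
for ALL `k`, together with box continuity (C) and an upper bound (U) on that box.  = idea-5 ed.2's `ModPkgAt` with `θ.cβ` carried and `ω` displayed as an
argument (so that a SUPPLIER names its modulus).  A PREDICATE, never asserted. [cite: Balaban1987RG1, (2.12)-(2.14) p.268; Balaban1988RG2Cluster, (2.39)-(2.41) p.21] -/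
def ModAtN (F : T4Family) (κ : StepColourData) (θ : Node00.Stage13HParams F 2) (hP : θ.Provisos₁₃SepCoPH F 2) (ω : ℝ → ℝ) : Prop :=
  ∃ γ₀ β' : ℝ, 0 < γ₀ ∧ γ₀ ≤ θ.γ ∧ 0 ≤ β' ∧
    (∀ (k : ℕ) (p : Fin (k + 1) → ℝ), p ∈ B12Beta.HistBox γ₀ k →
        |(Node00.datumOfRecord₁₃SepCoPH F 2 θ hP).βfun k p - θ.cβ * beta0OfJs F κ k| ≤ ω (p (Fin.last k))) ∧
    BetaContH γ₀ (Node00.datumOfRecord₁₃SepCoPH F 2 θ hP).βfun ∧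
    BetaUpperH β' γ₀ (Node00.datumOfRecord₁₃SepCoPH F 2 θ hP).βfun

/-- **NEW STUB SHAPE 2ᴾ «PEELING MODULUS AT NAMED JETS» `PeelAtNEachJets`** (this card's load-bearing hypothesis): at every admissible Stage-13 tuple SOME colour datum
`κ` (AFTER `θ`) and peeling letters `K ε a c V` (`ε ≠ 0`, `0 < a < 1`, `0 < c`; intended `ε = θ.ε₂₉`, not forced) give `ModAtN F κ θ hP (peelModulus K ε a c V)`:
`|β_{k+1}(p) − θ.cβ·β⁰_k(κ)| ≤ K·ε·p_k^a + V·exp(−c·ε²·p_k^{2a−2})`, ALL `k`.  Printed locus of the device: [Balaban1987RG1] p. 266 «Another possibility is to take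
g_k∕γ_k ε₁ instead of ε₁», [Balaban1988RG2Cluster] p. 8 after (1.29) «use the expression g_k|B| instead of ε₁. It gives a better bound» — carried out NOWHERE in
print; here as an INNER split of the record's FIXED small-field region at the coupling-scaled threshold `ε g_k^a` (the record's `chiFixed29` untouched), the
shell `ε g_k^a ≤ |B′| < ε` priced by the Gaussian large-deviation weight of the `k`-uniformly gapped fluctuation covariance.  NOT PRINTED; a hypothesis SHAPE,
never a fact. -/
def PeelAtNEachJets : Prop :=
  ∀ (F : T4Family) (θ : Node00.Stage13HParams F 2) (hP : θ.Provisos₁₃SepCoPH F 2), θ.Admissible F 2 →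
    ∃ (κ : StepColourData) (K ε a c V : ℝ), ε ≠ 0 ∧ 0 < a ∧ a < 1 ∧ 0 < c ∧ ModAtN F κ θ hP (peelModulus K ε a c V)

/-- the mechanism-agnostic modulus stub 2ᴹᴺ (what idea-5 ed.2's engine, or any other supplier, may land instead): SOME vanishing modulus, `κ` after `θ`. [folklore] -/
def ModAtNEachJets : Prop :=
  ∀ (F : T4Family) (θ : Node00.Stage13HParams F 2) (hP : θ.Provisos₁₃SepCoPH F 2), θ.Admissible F 2 →
    ∃ (κ : StepColourData) (ω : ℝ → ℝ), VanishesAtZero ω ∧ ModAtN F κ θ hP ω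

/-- peeling ⟹ modulus (kernel). [folklore] -/
theorem modAtNEachJets_of_peel (h : PeelAtNEachJets) : ModAtNEachJets := by
  intro F θ hP hθ
  obtain ⟨κ, K, ε, a, c, V, hε, ha0, ha1, hc, hM⟩ := h F θ hP hθ
  exact ⟨κ, peelModulus K ε a c V, vanishesAtZero_peelModulus hε ha0 ha1 hc, hM⟩

/-- **(D1) SIDE, SHARED (not this card's business): row (D1) at every colour datum that SHADOWS the record at modulus grade** — `∃ A, OneLoopDrift (stepBal 2 F.L) A
(beta0OfJs F κ)` (= v3 stub 1′'s conclusion VERBATIM, row (D1) at `Lc := F.L`; discharged by «row (D1) at every colour datum» as in v3's `d1AtShadowingJets_of_d1Drift_all`).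
A hypothesis SHAPE, never a fact. [cite: Balaban1987RG1, (1.3) p.260 and (2.12)–(2.13) p.268] -/
def D1AtModShadowingJets : Prop :=
  ∀ (F : T4Family) (κ : StepColourData) (θ : Node00.Stage13HParams F 2) (hP : θ.Provisos₁₃SepCoPH F 2), θ.Admissible F 2 →
    (∃ ω : ℝ → ℝ, VanishesAtZero ω ∧ ModAtN F κ θ hP ω) →
    ∃ A : ℝ, OneLoopDrift (B12Normalization.stepBal 2 (F.L : ℝ)) A (beta0OfJs F κ)

/-- **THE MODULUS LINE's COMPOSITION AT THE RECORD (kernel, no sorry): `D1AtModShadowingJets → ModAtNEachJets → K2⁷'s TEXT`** — verbatim the crux statement; SEAM-FREE: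
for the slope `s := θ.cβ · stepBal 2 F.L > 0` (`Stage9Params.Admissible.chart`, `stepBal_L_pos`) shrink the box until `ω ≤ s` and call an4's
`endpointExistence_of_drift_constRemainder` BY NAME with the `θ.cβ`-scaled drift (`oneLoopDrift_const_mul`); `(B)` and the window hypothesis are carried unused exactly as
in the registered lines. -/
theorem EndpointGivenBR13SepCoPH_of_modN (h₁ : D1AtModShadowingJets) (h₂ : ModAtNEachJets) :
    Summit.QuantumFields.YangMills.Theses.BalabanUVNodes.EndpointGivenBR13SepCoPH := by
  intro F θ hP _hU hθ _hB _hwin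
  obtain ⟨κ, ω, hω, hpkg⟩ := h₂ F θ hP hθ
  obtain ⟨A, hdrift⟩ := h₁ F κ θ hP hθ ⟨ω, hω, hpkg⟩
  obtain ⟨γ₀, β', hγ₀, _hγ₀le, hβ', hM, hcont, hup⟩ := hpkg
  have hcβ : 0 < θ.cβ := hθ.toStage12.toStage9.chart.1
  have hs : 0 < θ.cβ * B12Normalization.stepBal 2 (F.L : ℝ) := mul_pos hcβ (stepBal_L_pos (F := F) two_pos)
  obtain ⟨δ, hδ, hδs⟩ := hω _ hs
  have hle : min γ₀ δ ≤ γ₀ := min_le_left _ _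
  refine endpointExistence_of_drift_constRemainder (Node00.datumOfRecord₁₃SepCoPH F 2 θ hP).fwd (lt_min hγ₀ hδ)
    (oneLoopDrift_const_mul hdrift θ.cβ) (r := θ.cβ * B12Normalization.stepBal 2 (F.L : ℝ)) ?_ le_rfl hβ'
    (fun k => (hcont k).mono (box_mono hle k)) (fun k v hv => hup k v (box_mono hle k hv))
  intro k p hp
  have hp' : p ∈ B12Beta.HistBox γ₀ k := fun i => ⟨(hp i).1, (hp i).2.trans hle⟩
  exact (hM k p hp').trans (hδs _ (hp (Fin.last k)).1 ((hp (Fin.last k)).2.trans (min_le_right _ _)))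

/-- **… and from the PEELING shape itself: `D1AtModShadowingJets → PeelAtNEachJets → K2⁷`** (kernel, no sorry). -/
theorem EndpointGivenBR13SepCoPH_of_peelN (h₁ : D1AtModShadowingJets) (h₂ : PeelAtNEachJets) :
    Summit.QuantumFields.YangMills.Theses.BalabanUVNodes.EndpointGivenBR13SepCoPH :=
  EndpointGivenBR13SepCoPH_of_modN h₁ (modAtNEachJets_of_peel h₂)

/-- the modulus package also delivers LINE 2's per-scale ANCHOR at the named numbers, `k`-uniformly and for free (what idea-7's S2 wanted; here at the sanctioned key):
`∀ k s>0 ∃ γ>0 ∀ p ∈ ]0,γ]^{k+1}, |β_{k+1}(p) − θ.cβ·β⁰_k(κ)| ≤ s`. [folklore] -/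
theorem anchor_of_modAtN {F : T4Family} {κ : StepColourData} {θ : Node00.Stage13HParams F 2} {hP : θ.Provisos₁₃SepCoPH F 2} {ω : ℝ → ℝ}
    (hω : VanishesAtZero ω) (h : ModAtN F κ θ hP ω) (s : ℝ) (hs : 0 < s) :
    ∃ γ : ℝ, 0 < γ ∧ ∀ (k : ℕ) (p : Fin (k + 1) → ℝ), p ∈ B12Beta.HistBox γ k →
      |(Node00.datumOfRecord₁₃SepCoPH F 2 θ hP).βfun k p - θ.cβ * beta0OfJs F κ k| ≤ s := by
  obtain ⟨γ₀, β', hγ₀, _, _, hM, _, _⟩ := h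
  obtain ⟨δ, hδ, hδs⟩ := hω s hs
  refine ⟨min γ₀ δ, lt_min hγ₀ hδ, fun k p hp => ?_⟩
  have hp' : p ∈ B12Beta.HistBox γ₀ k := fun i => ⟨(hp i).1, (hp i).2.trans (min_le_left _ _)⟩
  exact (hM k p hp').trans (hδs _ (hp (Fin.last k)).1 ((hp (Fin.last k)).2.trans (min_le_right _ _)))

end NamedNumbers

end Summit.QuantumFields.YangMills.Cruxes.EndpointGivenBR13SepCoPH.Idea2g2

end
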